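import Summits.KontsevichZagierPeriods.KontsevichZagierPeriods.Theses.DimensionBudget
import Literature.NumberTheory.Transcendental.KZCubicalCalculus
import Literature.NumberTheory.Transcendental.KZRelationsLE

/-!
# Line `ayoub-span-within-one` for crux `CubicalKernelWithinOne` (stmt-KontsevichZagierPeriods-18187),
# piece 2 of the split of `DimensionBudget.BudgetThesis` (stmt-KontsevichZagierPeriods-3748)

Skeleton (birth certificate BC3): two registered stubs and the kernel-checked composition
`CubicalKernelWithinOne_of` concluding the route decl BY NAME.

* `stub_ayoubKernelWithin` — TRANSCENDENCE (hardest; Kontsevich's period conjecture in Ayoub's cubical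
  presentation, with the route's dimension budget): a `ℤ`-combination of tame cubes of dimensions `≤ K`
  with value `0` lies in the span of the four cubical move families of `KZCubicalCalculus.lean`
  (linearity, Stokes along the last coordinate, self-maps of the cube, dyadic subdivision — the tree's
  rendering of Ayoub's compact presentation, Ayoub 2014 §2.2 Def. 10 / Prop. 11) supported in
  dimension `≤ K + 1`.
* `stub_ayoubSpanWithin` — REALISATION inside the same dimension (M): that truncated span lies in
  `KZ.relationsLE d`: three families are literally single moves of the calculus
  (`KZ.cubicalLinGens_subset_integrandAddRel`, `…CovGens_subset_changeOfVariablesRel`,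
  `…StokesGens_subset_newtonLeibnizRel`), hence in `movesLE d` as soon as they lie in `formalRepLE d`;
  a subdivision generator is the sum of one domain-additivity and two change-of-variables instances
  among cubes of ITS dimension `n` (`KZ.cubicalSubdivGens_subset_relations`), and `n ≤ d` follows from
  membership in `formalRepLE d` by freeness of `FormalRep` (support argument, cf. the landed
  `AbelContraction.TorsionFreeBudget`).

Honours the route's kill criterion: a `+2 is needed` theorem on cubes refutes `stub_ayoubKernelWithin`
(and the crux) without touching the summit; the unbudgeted shadow of the crux follows from Conjecture 1.
-/

-- single-conjunct summit: Sub = Summit (CONVENTIONS §2)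
set_option linter.dupNamespace false

open Literature.NumberTheory.Transcendental

namespace Summit.KontsevichZagierPeriods.KontsevichZagierPeriods.Cruxes.CubicalKernelWithinOne.AyoubSpanWithinOne

/-- **S1 `stub_ayoubKernelWithin` (transcendence; hardest stub).** For every `K`, every `ℤ`-combination
`x` of tame cube representations of dimensions `≤ K` with `KZ.eval x = 0` lies in the subgroup generated
by the cubical move instances (`KZ.cubicalLinGens ∪ cubicalStokesGens ∪ cubicalCovGens ∪ cubicalSubdivGens`)
supported in dimension `≤ K + 1`. Kontsevich's period conjecture in Ayoub's presentation
[Ayoub 2014, §2.2 Prop. 11 and the Conjecture after it; Huber–Müller-Stach 2017, Ch. 13], sharpened by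
the route's budget `+1` [Ayoub 2015, Rem. 1.2 / 1.5 ask how many variables are needed].
Size: open-problem (GPC strength on the cubical sector). -/
theorem stub_ayoubKernelWithin : ∀ (K : ℕ) (x : KZ.FormalRep),
    x ∈ AddSubgroup.closure {y : KZ.FormalRep | ∃ (j : ℕ) (t : KZ.IntegralRep j),
      j ≤ K ∧ t.IsTameCube ∧ y = KZ.of t} →
    KZ.eval x = 0 →
    x ∈ AddSubgroup.closure ((KZ.cubicalLinGens ∪ KZ.cubicalStokesGens ∪ KZ.cubicalCovGens ∪
      KZ.cubicalSubdivGens) ∩ (KZ.formalRepLE (K + 1) : Set KZ.FormalRep)) := by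
  sorry

/-- **S2 `stub_ayoubSpanWithin` (realisation inside the same dimension; size M).** The cubical move
instances supported in dimension `≤ d` generate a subgroup of the truncated relations `KZ.relationsLE d`:
linearity / self-map / Stokes instances are single moves of the Kontsevich–Zagier calculus
(`KZ.cubicalLinGens_subset_integrandAddRel`, `KZ.cubicalCovGens_subset_changeOfVariablesRel`,
`KZ.cubicalStokesGens_subset_newtonLeibnizRel`), hence lie in `KZ.movesLE d`; a subdivision instance in
dimension `n` is one domain-additivity plus two change-of-variables instances among cubes of dimension `n`
(`KZ.cubicalSubdivGens_subset_relations`), and `n ≤ d` by freeness of `FormalRep`.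
[Kontsevich–Zagier 2001, §1.2 rules (1)–(3)] -/
theorem stub_ayoubSpanWithin : ∀ d : ℕ,
    AddSubgroup.closure ((KZ.cubicalLinGens ∪ KZ.cubicalStokesGens ∪ KZ.cubicalCovGens ∪
      KZ.cubicalSubdivGens) ∩ (KZ.formalRepLE d : Set KZ.FormalRep)) ≤ KZ.relationsLE d := by
  sorry

/-- **Composition**: S1 (kernel ⊆ truncated Ayoub span) and S2 (truncated Ayoub span ⊆ truncated
relations) give the crux `CubicalKernelWithinOne` of route DimensionBudget (its tame-cube hypothesis is
`KZ.IntegralRep.IsTameCube` unfolded, definitionally). [Kontsevich–Zagier 2001, §1.2] -/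
theorem CubicalKernelWithinOne_of_stubs :
    (∀ (K : ℕ) (x : KZ.FormalRep),
      x ∈ AddSubgroup.closure {y : KZ.FormalRep | ∃ (j : ℕ) (t : KZ.IntegralRep j),
        j ≤ K ∧ t.IsTameCube ∧ y = KZ.of t} →
      KZ.eval x = 0 →
      x ∈ AddSubgroup.closure ((KZ.cubicalLinGens ∪ KZ.cubicalStokesGens ∪ KZ.cubicalCovGens ∪
        KZ.cubicalSubdivGens) ∩ (KZ.formalRepLE (K + 1) : Set KZ.FormalRep))) →
    (∀ d : ℕ,
      AddSubgroup.closure ((KZ.cubicalLinGens ∪ KZ.cubicalStokesGens ∪ KZ.cubicalCovGens ∪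
        KZ.cubicalSubdivGens) ∩ (KZ.formalRepLE d : Set KZ.FormalRep)) ≤ KZ.relationsLE d) →
    Summit.KontsevichZagierPeriods.KontsevichZagierPeriods.Theses.DimensionBudget.CubicalKernelWithinOne :=
  fun h1 h2 K x hx h0 => h2 (K + 1) (h1 K x hx h0)

/-- **Registered composition** (the two stubs BY NAME): the crux `CubicalKernelWithinOne` of route
DimensionBudget from `stub_ayoubKernelWithin` and `stub_ayoubSpanWithin`. [Kontsevich–Zagier 2001, §1.2] -/
theorem CubicalKernelWithinOne_of :
    Summit.KontsevichZagierPeriods.KontsevichZagierPeriods.Theses.DimensionBudget.CubicalKernelWithinOne :=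
  CubicalKernelWithinOne_of_stubs stub_ayoubKernelWithin stub_ayoubSpanWithin

end Summit.KontsevichZagierPeriods.KontsevichZagierPeriods.Cruxes.CubicalKernelWithinOne.AyoubSpanWithinOne
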